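import Mathlib
import HarnessLib
import Summits.ResolutionOfSingularities.ResolutionOfSingularities.Theorems.WildQuotientsWildQuotientResolutionS1aG1
import Summits.ResolutionOfSingularities.ResolutionOfSingularities.Theorems.WildQuotientsWildQuotientResolutionS1aKillHalfCover

/-!
# S1a — `AuxTop` (A1-glob): THE TYPED CUT OF THE AUX HALF, and the FORMAL locality lemma (A3) `AuxTop ⇒ AUX branch`

[OURS · L1 W4.5c · lead-1 g8; plan-1 g12 STRATEGY-DESIGN v3.5 §1/§4 (ea6d3c2c9ab8c960), ASSIGNMENT v10.11 row 1 as amended] — NOT statements of the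
manuscript; counted 0; AI-level work, weaker than expert review. Crux stmt-ResolutionOfSingularities-17941, line `s1a-logminvertex` v6, stub
`stub_winningStrategy`. Route-independent.

* `GameFrame.GModel.isGoodAt_of_move_of_not_mem_support` — GOODNESS TRANSPORTS across the idle region of ANY move whose centre has a `G`-stable support;
* **`GameFrame.GModel.AuxTopAt M`** (research def, per model; plan-1's AuxTop = A1-glob, second typing of §1): an AUX centre `(𝒦, d)` (the admissibility
  clause of the AUX branch of `KillOrAuxRuleJInfOn`, verbatim), a `G`-stable closed `Z ⊆ nonKillable M` with `dim (nonKillable M ∖ Z) < jInf M` and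
  `Z ⊆ supp (𝒦.ideal d)`, such that along EVERY move of `(𝒦, d)` every BAD point over the support is killable. Recipe table v2 (STRATEGY-DESIGN v3.5 §2;
  how `AuxTopAt` is met on every census specimen, THETA-LP-CENSUS v1–v5): ★ uniform row «common line of `k` bad planes → weights `(k+1,1,1)`», jump line
  `(3,1,2)`, cusp line `(9,3,2)`, disjoint unions in one move; lesson L-OBJ: recipes are ∃-data, NOT LP-minimal vertices — hence an ∃-statement, no per-type
  defs. First «why it might fail»: `G`-STABILITY of the aux filtration off the census (plan-1 (T9));
* `AuxTopOn p q G ρ g₀ P` (relative to a class `P` of models), `AuxTopReach p` (datum-relative, binders of `AuxHalfReach` verbatim), `KillHalfCoverReach p`;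
* **(A3) FORMAL**: `exists_isInducing_nonKillable_diff` (the non-killable locus of such a move EMBEDS into `nonKillable M ∖ Z`), ★ `auxAlt_of_auxTopAt`
  (`AuxTopAt M → AuxAlt M` over a Noetherian base), `auxHalfJInfOn_of_auxTopOn`, `auxHalfReach_of_auxTopReach`, `killHalfReach_of_killHalfCoverReach`,
  `killOrAuxRuleJInfReach_of_killHalfCoverReach_of_auxTopReach`. Ingredients (all in tree): `killableAt_of_move_of_mem_support` (p611093), `g1` (p612119),
  `IsBlowup.isIso_morphismRestrict`, Krull-dimension monotonicity under an inducing map.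
-/

set_option linter.dupNamespace false

noncomputable section

open CategoryTheory Limits AlgebraicGeometry TopologicalSpace Topology
open Literature.AlgebraicGeometry.Resolution Literature.AlgebraicGeometry.RelativeSpec
open Summit.ResolutionOfSingularities.ResolutionOfSingularities.Theorems.WildQuotientResolution.S1
open Summit.ResolutionOfSingularities.ResolutionOfSingularities.Theorems.WildQuotientResolution.S1.NodeAtlas
open Summit.ResolutionOfSingularities.ResolutionOfSingularities.Theorems.WildQuotientResolution.S1.BlowupCharts
open Summit.ResolutionOfSingularities.ResolutionOfSingularities.Theorems.WildQuotientResolution.S1.GoodCharts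
open Summit.ResolutionOfSingularities.ResolutionOfSingularities.Theorems.WildQuotientResolution.S1.KillableTransport
open Summit.ResolutionOfSingularities.ResolutionOfSingularities.Theorems.WildQuotientResolution.S1.G1Proof

namespace Summit.ResolutionOfSingularities.ResolutionOfSingularities.Theorems.WildQuotientResolution.S1

namespace GameFrame.GModel

variable {p : ℕ} {X' X₁ : Scheme.{0}} {q : X' ⟶ X₁} {G : Type} [Group G] {ρ : G →* Aut X'} {g₀ : G}

/-! ## Goodness transports across the idle region of any move -/

/-- **GOODNESS TRANSPORTS ACROSS THE IDLE REGION OF ANY MOVE**: along a move `π' : Mʼ → M` blowing up `𝒦.ideal d` whose support has a `G`-stable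
complement, a point `v'` whose image lies OFF the support and is good is good. (Same proof as `isGoodAt_of_isIdleChart`, the good neighbourhood being
shrunk into the idle region instead of an idle chart.) [OURS · L1 W4.5c] -/
theorem isGoodAt_of_move_of_not_mem_support [Finite G] (M M' : GModel p q G ρ g₀) (hG : ∀ g : G, g ∈ Subgroup.zpowers g₀)
    (𝒦 : ReesFiltration M.V) (d : ℕ) (π' : M'.V ⟶ M.V) (hbl : IsBlowup π' (𝒦.ideal d)) (hr : M'.r = π' ≫ M.r)
    (hcomm : ∀ g : G, (M'.act.aut g).hom ≫ π' = π' ≫ (M.act.aut g).hom)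
    (hsuppG : ∀ g : G, (M.act.aut g).hom ⁻¹ᵁ (𝒦.ideal d).support.compl = (𝒦.ideal d).support.compl)
    {v' : M'.V} (hv' : π'.base v' ∉ ((𝒦.ideal d).support : Set M.V)) (hgood : M.IsGoodAt (π'.base v')) : M'.IsGoodAt v' := by
  -- a good neighbourhood inside the idle region
  obtain ⟨O₂, hvO₂, hO₂W, hO₂, htame₂⟩ := M.exists_good_le hG hgood (𝒦.ideal d).support.compl hsuppG hv'
  -- `π'` is an isomorphism over it
  have hdisj : Disjoint (O₂.1 : Set M.V) (𝒦.ideal d).support := by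
    rw [Set.disjoint_iff]
    rintro x ⟨hx, hx'⟩
    exact hO₂W hx hx'
  haveI hiso : IsIso (π' ∣_ O₂.1) := hbl.isIso_morphismRestrict hdisj
  haveI hP : IsIso (π'.appLE O₂.1 (π' ⁻¹ᵁ O₂.1) le_rfl) := isIso_app_of_isIso_morphismRestrict O₂.1 hiso
  -- the pulled-back chart
  have hstab : ∀ g : G, (M'.act.aut g).hom ⁻¹ᵁ (π' ⁻¹ᵁ O₂.1) = π' ⁻¹ᵁ O₂.1 := preimage_stable_of_comm M M' π' hcomm O₂.1 O₂.2.1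
  haveI : IsAffineHom ((π' ⁻¹ᵁ O₂.1).ι ≫ M'.r) := by
    rw [hr, ← Category.assoc, ← morphismRestrict_ι, Category.assoc]
    haveI := O₂.2.2
    infer_instance
  have hO₂' : IsAffineOpen (π' ⁻¹ᵁ O₂.1) := by
    haveI : IsAffine (O₂.1 : Scheme) := hO₂
    exact IsAffine.of_isIso (π' ∣_ O₂.1)
  let O₂' : M'.act.StableAffineOpens := ⟨π' ⁻¹ᵁ O₂.1, hstab, inferInstance⟩
  obtain ⟨P, hPapply⟩ : ∃ P : Γ(M.V, O₂.1) ≃+* Γ(M'.V, π' ⁻¹ᵁ O₂.1), ∀ s, P s = π'.appLE O₂.1 (π' ⁻¹ᵁ O₂.1) le_rfl s :=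
    ⟨(asIso (π'.appLE O₂.1 (π' ⁻¹ᵁ O₂.1) le_rfl)).commRingCatIsoToRingEquiv, fun _ => rfl⟩
  refine M'.isGoodAt_of_nodeChart_invariants hG v' O₂' hvO₂ hO₂' P.symm (actO M.act O₂ g₀) (fun t => ?_) htame₂
  obtain ⟨s, rfl⟩ := P.surjective t
  have h1 : (M'.act.aut g₀⁻¹).hom.appLE (π' ⁻¹ᵁ O₂.1) (π' ⁻¹ᵁ O₂.1) (hstab g₀⁻¹).ge (P s) = P (actO M.act O₂ g₀ s) := by
    rw [hPapply, hPapply]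
    exact appLE_comm_of_le M.act M'.act hcomm O₂.1 O₂.2.1 (π' ⁻¹ᵁ O₂.1) hstab le_rfl g₀⁻¹ s
  change P.symm ((M'.act.aut g₀⁻¹).hom.appLE O₂'.1 O₂'.1 (O₂'.2.1 g₀⁻¹).ge (P s)) = actO M.act O₂ g₀ (P.symm (P s))
  rw [P.symm_apply_apply]
  exact (congrArg P.symm h1).trans (P.symm_apply_apply _)

/-- Contrapositive: a BAD point of the move lying over the idle region lies over a BAD point. -/
theorem base_mem_badLocus_of_move [Finite G] (M M' : GModel p q G ρ g₀) (hG : ∀ g : G, g ∈ Subgroup.zpowers g₀)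
    (𝒦 : ReesFiltration M.V) (d : ℕ) (π' : M'.V ⟶ M.V) (hbl : IsBlowup π' (𝒦.ideal d)) (hr : M'.r = π' ≫ M.r)
    (hcomm : ∀ g : G, (M'.act.aut g).hom ≫ π' = π' ≫ (M.act.aut g).hom)
    (hsuppG : ∀ g : G, (M.act.aut g).hom ⁻¹ᵁ (𝒦.ideal d).support.compl = (𝒦.ideal d).support.compl)
    {v' : M'.V} (hv' : π'.base v' ∉ ((𝒦.ideal d).support : Set M.V)) (hbad : v' ∈ M'.badLocus) : π'.base v' ∈ M.badLocus :=
  fun hgood => hbad (isGoodAt_of_move_of_not_mem_support M M' hG 𝒦 d π' hbl hr hcomm hsuppG hv' hgood)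

/-! ## `AuxTopAt` — the typed cut of the AUX half (research def) -/

/-- **`AuxTopAt M`** (plan-1ʼs AuxTop = A1-glob, STRATEGY-DESIGN v3.5 §1; OURS CANDIDATE research statement, asserted nowhere): there are an AUX centre
`(𝒦, d)` — admissible, principal-or-idle at the good points (the admissibility clause of the AUX branch of `KillOrAuxRuleJInfOn`, verbatim) — and a
`G`-stable closed `Z ⊆ nonKillable M` of co-small complement (`dim (nonKillable M ∖ Z) < jInf M`; e.g. the union of the top-dimensional components)
contained in the SUPPORT of `𝒦.ideal d`, such that along every move of `(𝒦, d)` every BAD point lying over the support is KILLABLE. Nothing is asked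
off the support. Census recipes meeting it (v3.5 §2, ∃-data per component type, L-OBJ): uniform row `(k+1,1,1)` on the common line of `k` bad planes,
jump line `(3,1,2)`, cusp line `(9,3,2)`, disjoint unions in one move. [OURS · L1 W4.5c] -/
def AuxTopAt (M : GModel p q G ρ g₀) : Prop :=
  ∃ (𝒦 : ReesFiltration M.V) (d : ℕ), IsAuxCentre p M.act g₀ 𝒦 d (M.badLocus)ᶜ ∧
    ∃ Z : Set M.V, IsClosed Z ∧ (∀ g : G, (M.act.aut g).hom.base ⁻¹' Z = Z) ∧ Z ⊆ M.nonKillable ∧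
      topologicalKrullDim ↥(M.nonKillable \ Z) < M.jInf ∧ Z ⊆ ((𝒦.ideal d).support : Set M.V) ∧
      ∀ (M' : GModel p q G ρ g₀) (π' : M'.V ⟶ M.V), IsBlowup π' (𝒦.ideal d) → M'.π = π' ≫ M.π → M'.r = π' ≫ M.r →
        (∀ g : G, (M'.act.aut g).hom ≫ π' = π' ≫ (M.act.aut g).hom) →
        ∀ v' ∈ M'.badLocus, π'.base v' ∈ ((𝒦.ideal d).support : Set M.V) → M'.KillableAt v'

/-! ## (A3) FORMAL: the non-killable locus of such a move embeds into `nonKillable M ∖ Z` -/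

/-- **THE NON-KILLABLE LOCUS OF A MOVE KILLABLE OVER THE SUPPORT EMBEDS INTO `nonKillable M ∖ Z`** for every `Z` inside the support: a bad
non-killable `v'` has `π' v' ∉ supp` (else killable), `π' v'` is bad (goodness transports) and NOT killable (else `v'` is, by
`killableAt_of_move_of_mem_support` with its support hypothesis supplied by G1 at the bad point `π' v'`); and `π'` is a homeomorphism over the idle
region. [OURS · L1 W4.5c] -/
theorem exists_isInducing_nonKillable_diff [Finite G] (hp : p.Prime) (hG : ∀ g : G, g ∈ Subgroup.zpowers g₀)
    (M M' : GModel p q G ρ g₀) (hB : M.HasNoetherianBase) (𝒦 : ReesFiltration M.V) (d : ℕ)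
    (h𝒦G : ∀ g : G, (𝒦.ideal d).comap (M.act.aut g).hom = 𝒦.ideal d)
    (π' : M'.V ⟶ M.V) (hbl : IsBlowup π' (𝒦.ideal d)) (hr : M'.r = π' ≫ M.r)
    (hcomm : ∀ g : G, (M'.act.aut g).hom ≫ π' = π' ≫ (M.act.aut g).hom)
    (hkill : ∀ v' ∈ M'.badLocus, π'.base v' ∈ ((𝒦.ideal d).support : Set M.V) → M'.KillableAt v')
    {Z : Set M.V} (hZ : Z ⊆ ((𝒦.ideal d).support : Set M.V)) :
    ∃ ψ : ↥M'.nonKillable → ↥(M.nonKillable \ Z), IsInducing ψ := by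
  have hsuppG := fun g => preimage_support_compl_of_comap_eq M (I := 𝒦.ideal d) h𝒦G g
  let W : M.V.Opens := (𝒦.ideal d).support.compl
  -- bad non-killable points of `Mʼ` lie over the idle region `W`
  have hW : ∀ v' : ↥M'.nonKillable, v'.1 ∈ π' ⁻¹ᵁ W := fun v' hs => v'.2.2 (hkill v'.1 v'.2.1 hs)
  -- and over non-killable points of `M` off `Z`
  have key : ∀ v' : ↥M'.nonKillable, π'.base v'.1 ∈ M.nonKillable \ Z := fun v' => by
    have hvW : π'.base v'.1 ∉ ((𝒦.ideal d).support : Set M.V) := hW v'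
    have hbad : π'.base v'.1 ∈ M.badLocus := base_mem_badLocus_of_move M M' hG 𝒦 d π' hbl hr hcomm hsuppG hvW v'.2.1
    refine ⟨⟨hbad, fun ⟨𝒦₂, d₂, O₂, hd₂, hvO₂, hO₂⟩ => v'.2.2 ?_⟩, fun hz => hvW (hZ hz)⟩
    have hvs : π'.base v'.1 ∈ ((𝒦₂.ideal d₂).support : Set M.V) := g1 hp q G ρ g₀ hG M 𝒦₂ d₂ O₂ hB hO₂ _ hvO₂ hbad
    exact killableAt_of_move_of_mem_support M M' 𝒦 d π' hbl hr hcomm hsuppG hvW hO₂ hd₂ hvO₂ hvs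
  -- `π'` is an isomorphism over `W`; the embedding factors through it
  haveI hiso : IsIso (π' ∣_ W) := hbl.isIso_morphismRestrict (U := W) (by
    rw [Set.disjoint_iff]; rintro x ⟨hx, hx'⟩; exact hx hx')
  let e : ↥(π' ⁻¹ᵁ W) ≃ₜ ↥W := Scheme.homeoOfIso (asIso (π' ∣_ W))
  let φ₀ : ↥M'.nonKillable → M.V := fun v' => ((e ⟨v'.1, hW v'⟩ : ↥W) : M.V)
  have hφ₀ : ∀ v', φ₀ v' = π'.base v'.1 := fun v' => by
    have h1 : (e ⟨v'.1, hW v'⟩ : ↥W) = (π' ∣_ W).base ⟨v'.1, hW v'⟩ := rfl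
    change ((e ⟨v'.1, hW v'⟩ : ↥W) : M.V) = _
    rw [h1]
    exact morphismRestrict_base_coe π' W ⟨v'.1, hW v'⟩
  have hind₀ : IsInducing φ₀ := by
    refine IsInducing.subtypeVal.comp (e.isInducing.comp ?_)
    exact (IsInducing.subtypeVal.codRestrict hW : IsInducing fun v' : ↥M'.nonKillable => (⟨v'.1, hW v'⟩ : ↥(π' ⁻¹ᵁ W)))
  have hmem₀ : ∀ v', φ₀ v' ∈ M.nonKillable \ Z := fun v' => by rw [hφ₀]; exact key v'
  exact ⟨Set.codRestrict φ₀ _ hmem₀, hind₀.codRestrict hmem₀⟩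

/-- **`jInf` DROPS STRICTLY along every move of an `AuxTopAt` datum.** [OURS · L1 W4.5c] -/
theorem jInf_lt_of_move_of_killable_over_support [Finite G] (hp : p.Prime) (hG : ∀ g : G, g ∈ Subgroup.zpowers g₀)
    (M M' : GModel p q G ρ g₀) (hB : M.HasNoetherianBase) (𝒦 : ReesFiltration M.V) (d : ℕ)
    (h𝒦G : ∀ g : G, (𝒦.ideal d).comap (M.act.aut g).hom = 𝒦.ideal d)
    (π' : M'.V ⟶ M.V) (hbl : IsBlowup π' (𝒦.ideal d)) (hr : M'.r = π' ≫ M.r)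
    (hcomm : ∀ g : G, (M'.act.aut g).hom ≫ π' = π' ≫ (M.act.aut g).hom)
    (hkill : ∀ v' ∈ M'.badLocus, π'.base v' ∈ ((𝒦.ideal d).support : Set M.V) → M'.KillableAt v')
    {Z : Set M.V} (hZ : Z ⊆ ((𝒦.ideal d).support : Set M.V)) (hdim : topologicalKrullDim ↥(M.nonKillable \ Z) < M.jInf) :
    M'.jInf < M.jInf := by
  obtain ⟨ψ, hψ⟩ := exists_isInducing_nonKillable_diff hp hG M M' hB 𝒦 d h𝒦G π' hbl hr hcomm hkill hZ
  exact lt_of_le_of_lt hψ.topologicalKrullDim_le hdim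

/-- ★ **(A3) FORMAL — `AuxTopAt M ⇒ AuxAlt M`** over a Noetherian base: the AUX centre of `AuxTopAt` IS an AUX alternative of the rule of record
(all its moves strictly lower `jInf`). [OURS · L1 W4.5c] -/
theorem auxAlt_of_auxTopAt [Finite G] (hp : p.Prime) (hG : ∀ g : G, g ∈ Subgroup.zpowers g₀) (M : GModel p q G ρ g₀)
    (hB : M.HasNoetherianBase) (h : M.AuxTopAt) : M.AuxAlt := by
  obtain ⟨𝒦, d, haux, Z, -, -, -, hdim, hZ, hkill⟩ := h
  refine ⟨𝒦, d, haux, fun M' hmv => ?_⟩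
  obtain ⟨π', hbl, hπ, hr, hcomm⟩ := hmv
  exact jInf_lt_of_move_of_killable_over_support hp hG M M' hB 𝒦 d (fun g => haux.1.2.1 g d) π' hbl hr hcomm
    (hkill M' π' hbl hπ hr hcomm) hZ hdim

end GameFrame.GModel

/-! ## Relative and datum-relative forms -/

/-- **`AuxTopOn p q G ρ g₀ P`** — `AuxTopAt` at every non-terminal `P`-model over a Noetherian base with a non-killable bad point (`jInf ≠ ⊥`); the
A-side residual after the cut (A) ⇐ AuxTop ∧ (A3). [OURS · L1 W4.5c] -/
def AuxTopOn (p : ℕ) {X' X₁ : Scheme.{0}} (q : X' ⟶ X₁) (G : Type) [Group G] (ρ : G →* Aut X') (g₀ : G)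
    (P : GameFrame.GModel p q G ρ g₀ → Prop) : Prop :=
  ∀ M : GameFrame.GModel p q G ρ g₀, P M → M.HasNoetherianBase → ¬ M.Terminal → M.jInf ≠ ⊥ → M.AuxTopAt

/-- **(A3) relative form**: for a class `P` stable under admissible moves, `AuxTopOn … P ⇒ AuxHalfJInfOn … P`. [OURS · L1 W4.5c] -/
theorem auxHalfJInfOn_of_auxTopOn {p : ℕ} (hp : p.Prime) {X' X₁ : Scheme.{0}} {q : X' ⟶ X₁} {G : Type} [Group G] [Finite G]
    {ρ : G →* Aut X'} {g₀ : G} (hG : ∀ g : G, g ∈ Subgroup.zpowers g₀) {P : GameFrame.GModel p q G ρ g₀ → Prop}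
    (hP : ∀ (M M' : GameFrame.GModel p q G ρ g₀) (𝒦 : ReesFiltration M.V) (d : ℕ),
      P M → IsAdmissibleCentre p M.act g₀ 𝒦 d → M.IsMoveOf M' 𝒦 d → P M')
    (h : AuxTopOn p q G ρ g₀ P) : AuxHalfJInfOn p q G ρ g₀ P := by
  intro M hPM hB hT hj
  obtain ⟨𝒦, d, haux, hmoves⟩ := GameFrame.GModel.auxAlt_of_auxTopAt hp hG M hB (h M hPM hB hT hj)
  exact ⟨𝒦, d, haux, fun M' hmv => ⟨hP M M' 𝒦 d hPM haux.1 hmv, hmoves M' hmv⟩⟩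

/-- **Cover half + `AuxTopOn` ⇒ the relative rule `KillOrAuxRuleJInfOn … P`** (for `P` stable under admissible moves). [OURS · L1 W4.5c] -/
theorem killOrAuxRuleJInfOn_of_cover_of_auxTopOn {p : ℕ} (hp : p.Prime) {X' X₁ : Scheme.{0}} {q : X' ⟶ X₁} {G : Type} [Group G] [Finite G]
    {ρ : G →* Aut X'} {g₀ : G} (hG : ∀ g : G, g ∈ Subgroup.zpowers g₀) {P : GameFrame.GModel p q G ρ g₀ → Prop}
    (hP : ∀ (M M' : GameFrame.GModel p q G ρ g₀) (𝒦 : ReesFiltration M.V) (d : ℕ),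
      P M → IsAdmissibleCentre p M.act g₀ 𝒦 d → M.IsMoveOf M' 𝒦 d → P M')
    (hK : KillHalfCoverOn p q G ρ g₀ P) (hA : AuxTopOn p q G ρ g₀ P) : KillOrAuxRuleJInfOn p q G ρ g₀ P :=
  killOrAuxRuleJInfOn_of_cover_of_aux hp hG hK (auxHalfJInfOn_of_auxTopOn hp hG hP hA)

/-- **`AuxTopReach p`** — `AuxTopAt` on the REACHABLE models of crux data (binders of `AuxHalfReach`, verbatim): the datum-relative A-side residual.
[OURS · L1 W4.5c] -/
def AuxTopReach (p : ℕ) : Prop :=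
  ∀ (k : Type) [Field k] [CharP k p] [PerfectField k] (X' X₁ : Scheme.{0})
    (f : X₁ ⟶ Spec (.of k)) (q : X' ⟶ X₁) (G : Type) [Group G] [Finite G]
    (ρ : G →* Aut X'), Nat.card G = p → IsSeparated f → LocallyOfFiniteType f → QuasiCompact f →
    IsIntegral X₁ → ∀ [IsIntegral X'], Scheme.IsRegular X' → IsFinite q → Function.Surjective q.base →
    (∃ U : X₁.Opens, Dense (U : Set X₁) ∧ Etale (q ∣_ U)) →
    ∀ (hq : ∀ g : G, (ρ g).hom ≫ q = q),
    (∀ x y : X', q.base x = q.base y → ∃ g : G, (ρ g).hom.base x = y) →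
    topologicalKrullDim X₁ ≤ 4 → Function.Injective ρ →
    ∀ (g₀ : G), (∀ g : G, g ∈ Subgroup.zpowers g₀) → ∀ [IsLocallyNoetherian X']
      (h₀ : NodeAtlas p (⟨ρ, hq⟩ : ActionOver q G) g₀),
      ∀ M : GameFrame.GModel p q G ρ g₀, (GameFrame.GModel.initial hq h₀).Reachable M → ¬ M.Terminal →
        M.jInf ≠ ⊥ → M.AuxTopAt

/-- **`KillHalfCoverReach p`** — the KILL half in COVER form on the reachable models of crux data: `jInf M = ⊥`, non-terminal ⇒ a principal centre whose
principal-centre charts COVER the bad locus (then every move is terminal: `jInf_eq_bot_of_isMoveOf_of_cover`). [OURS · L1 W4.5c] -/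
def KillHalfCoverReach (p : ℕ) : Prop :=
  ∀ (k : Type) [Field k] [CharP k p] [PerfectField k] (X' X₁ : Scheme.{0})
    (f : X₁ ⟶ Spec (.of k)) (q : X' ⟶ X₁) (G : Type) [Group G] [Finite G]
    (ρ : G →* Aut X'), Nat.card G = p → IsSeparated f → LocallyOfFiniteType f → QuasiCompact f →
    IsIntegral X₁ → ∀ [IsIntegral X'], Scheme.IsRegular X' → IsFinite q → Function.Surjective q.base →
    (∃ U : X₁.Opens, Dense (U : Set X₁) ∧ Etale (q ∣_ U)) →
    ∀ (hq : ∀ g : G, (ρ g).hom ≫ q = q),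
    (∀ x y : X', q.base x = q.base y → ∃ g : G, (ρ g).hom.base x = y) →
    topologicalKrullDim X₁ ≤ 4 → Function.Injective ρ →
    ∀ (g₀ : G), (∀ g : G, g ∈ Subgroup.zpowers g₀) → ∀ [IsLocallyNoetherian X']
      (h₀ : NodeAtlas p (⟨ρ, hq⟩ : ActionOver q G) g₀),
      ∀ M : GameFrame.GModel p q G ρ g₀, (GameFrame.GModel.initial hq h₀).Reachable M → ¬ M.Terminal →
        M.jInf = ⊥ → ∃ (𝒦 : ReesFiltration M.V) (d : ℕ), IsPrincipalCentre p M.act g₀ 𝒦 d ∧ M.badLocus ⊆ M.principalKillOpen 𝒦 d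

/-- **(A3) datum-relative**: `AuxTopReach p ⇒ AuxHalfReach p`. [OURS · L1 W4.5c] -/
theorem auxHalfReach_of_auxTopReach {p : ℕ} (hp : p.Prime) (h : AuxTopReach p) : AuxHalfReach p := by
  intro k _ _ _ X' X₁ f q G _ _ ρ hG hfs hfft hfqc hX₁ _ hreg hqfin hqs hqet hq horb hdim hinj g₀ hg₀ _ h₀ M hR hT hj
  haveI := hfft
  haveI := hfqc
  exact GameFrame.GModel.auxAlt_of_auxTopAt hp hg₀ M (GameFrame.GModel.hasNoetherianBase_of_datum f M)
    (h k X' X₁ f q G ρ hG hfs hfft hfqc hX₁ hreg hqfin hqs hqet hq horb hdim hinj g₀ hg₀ h₀ M hR hT hj)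

/-- **The cover form gives the KILL half**: `KillHalfCoverReach p ⇒ KillHalfReach p` (every move of a covering principal centre is terminal, so
`jInf` drops to `⊥`). [OURS · L1 W4.5c] -/
theorem killHalfReach_of_killHalfCoverReach {p : ℕ} (hp : p.Prime) (h : KillHalfCoverReach p) : KillHalfReach p := by
  intro k _ _ _ X' X₁ f q G _ _ ρ hG hfs hfft hfqc hX₁ _ hreg hqfin hqs hqet hq horb hdim hinj g₀ hg₀ _ h₀ M hR hT hj
  haveI := hfft
  haveI := hfqc
  obtain ⟨𝒦, d, hprin, hcov⟩ := h k X' X₁ f q G ρ hG hfs hfft hfqc hX₁ hreg hqfin hqs hqet hq horb hdim hinj g₀ hg₀ h₀ M hR hT hj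
  refine ⟨𝒦, d, hprin, M.hits_of_cover hcov, fun M' hmv => ?_⟩
  rw [GameFrame.GModel.jInf_eq_bot_of_isMoveOf_of_cover hp hg₀ M M' (GameFrame.GModel.hasNoetherianBase_of_datum f M) hprin hcov hmv]
  exact bot_le

/-- **THE RESIDUAL OF RECORD AFTER THE CUT**: `KillHalfCoverReach p ∧ AuxTopReach p ⇒ KillOrAuxRuleJInfReach p` — so the registered stub reads
`stub_winningStrategy ⇐ KillHalfCoverReach ∧ AuxTopReach` by name (`winningStrategy_of_killOrAuxRuleJInfReach`, p610439). [OURS · L1 W4.5c] -/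
theorem killOrAuxRuleJInfReach_of_killHalfCoverReach_of_auxTopReach {p : ℕ} (hp : p.Prime) (hK : KillHalfCoverReach p)
    (hA : AuxTopReach p) : KillOrAuxRuleJInfReach p :=
  killOrAuxRuleJInfReach_of_halves (killHalfReach_of_killHalfCoverReach hp hK) (auxHalfReach_of_auxTopReach hp hA)

end Summit.ResolutionOfSingularities.ResolutionOfSingularities.Theorems.WildQuotientResolution.S1

end
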